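import Mathlib
import Summits.Ventures.PercRepro2.HCov
import Summits.Ventures.PercRepro2.GcTransport
import Summits.Ventures.PercRepro2.GcHatConn
import Summits.Ventures.PercRepro2.GcHatConnPattern
import Summits.Ventures.PercRepro2.GcHatPush

/-!
# The hat scales the covariance form: `Gc = c³ · Gc'` (blind cell PercRepro2, typer-1 g56)

For a hat `u` (an unmarked vertex whose non-loop edges are exactly `{u, a₁}`, `{u, a₂}`, `{u, w}`)
every mass of `Gc` is `c` times the same mass on the hat graph under the hat weights: the
`Q`-restricted masses live on the admissible configurations, where the hat connectivity
(`conn_hatGraph_iff`) identifies the events and the hat pushforward (`prob_hat_pushforward`)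
identifies the laws up to `c`; the gap's inadmissible parts cancel on both sides (`a₁ ↔ a₂`
through `u`, resp. through `w`). `Gc` is cubic in the masses:

  **`Gc_hat`** : `Gc p ends = c³ · Gc (hatWeights p) (hatGraph ends)`,

the closure **`HCov_of_hat`** ((HCOV) on the hat graph gives (HCOV) on `G` at interior weights)
and the size drop are `GcHatClosure.lean`. Standard axioms.
-/

namespace Summit.Ventures.PercRepro2

open CovForm RECM

namespace Hat

section Scale

variable {V : Type*} {E : Type*} [Fintype E] [DecidableEq E] [DecidableEq V] {R : Type*} [Field R]
  {ends : E → Sym2 V} {u a₁ a₂ w : V} {e₁ e₂ e₃ : E}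

omit [DecidableEq V] in
/-- An event of the admissible configurations scales by `c` when it is carried by the hat map. -/
lemma prob_scale_of_Q (h : IsHatAt ends u a₁ a₂ w e₁ e₂ e₃) (p : E → R)
    (hN : hatN p e₁ e₂ e₃ ≠ 0) (hAN : hatA p e₁ e₂ e₃ + hatN p e₁ e₂ e₃ ≠ 0)
    (hBN : hatB p e₁ e₂ e₃ + hatN p e₁ e₂ e₃ ≠ 0) {X X' : Set (Config E)}
    (hXX : ∀ ω ∈ HatG e₁ e₂, ω ∈ X ↔ hatMap e₁ e₂ e₃ ω ∈ X') (hXQ : X ⊆ HatG e₁ e₂)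
    (hXQ' : X' ⊆ HatG e₂ e₃) :
    prob p X = hatC p e₁ e₂ e₃ * prob (hatWeights p e₁ e₂ e₃) X' := by
  have h1 : X = hatMap e₁ e₂ e₃ ⁻¹' X' ∩ HatG e₁ e₂ := by
    ext ω
    constructor
    · intro hω
      exact ⟨(hXX ω (hXQ hω)).1 hω, hXQ hω⟩
    · rintro ⟨hω, hG⟩
      exact (hXX ω hG).2 hω
  have h2 : X' = X' ∩ HatG e₂ e₃ := (Set.inter_eq_left.2 hXQ').symm
  rw [h1, prob_hat_pushforward h.e12 h.e13 h.e23 p hN hAN hBN, ← h2]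

omit [Fintype E] [DecidableEq E] [DecidableEq V] in
/-- A `Q`-event is admissible. -/
lemma subset_HatG_of_Q (h : IsHatAt ends u a₁ a₂ w e₁ e₂ e₃) {X : Set (Config E)}
    (hX : ∀ ω ∈ X, ¬ Conn ends ω a₁ a₂) : X ⊆ HatG e₁ e₂ :=
  fun ω hω => mem_HatG_of_not_conn h (hX ω hω)

omit [Fintype E] [DecidableEq V] in
/-- A `Q`-event on the hat graph is admissible. -/
lemma subset_HatG23_of_Q (h : IsHatAt ends u a₁ a₂ w e₁ e₂ e₃) {X : Set (Config E)}
    (hX : ∀ ω ∈ X, ¬ Conn (hatGraph ends a₁ a₂ w e₁ e₂ e₃) ω a₁ a₂) : X ⊆ HatG e₂ e₃ :=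
  fun ω hω => by
    by_contra hc
    exact hX ω hω (conn_roots_hat_of_not_mem_HatG h hc)

end Scale

section Masses

variable {V : Type*} {E : Type*} [Fintype E] [DecidableEq E] [DecidableEq V] {R : Type*} [Field R]
  {ends : E → Sym2 V} {a₁ a₂ u w : V} {e₁ e₂ e₃ : E}

/-- `P(Q ∩ X ∩ X')` scales (`X, X'` connection events off `u`). -/
lemma prob_Q_inter2_hat (h : IsHatAt ends u a₁ a₂ w e₁ e₂ e₃) (p : E → R)
    (hN : hatN p e₁ e₂ e₃ ≠ 0) (hAN : hatA p e₁ e₂ e₃ + hatN p e₁ e₂ e₃ ≠ 0)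
    (hBN : hatB p e₁ e₂ e₃ + hatN p e₁ e₂ e₃ ≠ 0) {x y z t : V} (hx : x ≠ u) (hy : y ≠ u)
    (hz : z ≠ u) (ht : t ≠ u) :
    prob p (avoidAll ends a₂ {a₁} ∩ (connEvent ends x y ∩ connEvent ends z t)) =
      hatC p e₁ e₂ e₃ * prob (hatWeights p e₁ e₂ e₃) (avoidAll (hatGraph ends a₁ a₂ w e₁ e₂ e₃) a₂
        {a₁} ∩ (connEvent (hatGraph ends a₁ a₂ w e₁ e₂ e₃) x y ∩
          connEvent (hatGraph ends a₁ a₂ w e₁ e₂ e₃) z t)) := by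
  refine prob_scale_of_Q h p hN hAN hBN ?_ ?_ ?_
  · intro ω hG
    simp only [Set.mem_inter_iff, avoidAll, Set.mem_setOf_eq, Finset.mem_singleton, forall_eq,
      connEvent, conn_hatGraph_iff h hG h.ua2.symm h.ua1.symm, conn_hatGraph_iff h hG hx hy,
      conn_hatGraph_iff h hG hz ht]
  · exact subset_HatG_of_Q h fun ω hω hc => hω.1 a₁ (Finset.mem_singleton_self a₁) (conn_symm hc)
  · exact subset_HatG23_of_Q h fun ω hω hc => hω.1 a₁ (Finset.mem_singleton_self a₁) (conn_symm hc)

/-- `P(Q ∩ X)` scales. -/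
lemma prob_Q_inter1_hat (h : IsHatAt ends u a₁ a₂ w e₁ e₂ e₃) (p : E → R)
    (hN : hatN p e₁ e₂ e₃ ≠ 0) (hAN : hatA p e₁ e₂ e₃ + hatN p e₁ e₂ e₃ ≠ 0)
    (hBN : hatB p e₁ e₂ e₃ + hatN p e₁ e₂ e₃ ≠ 0) {x y : V} (hx : x ≠ u) (hy : y ≠ u) :
    prob p (avoidAll ends a₂ {a₁} ∩ connEvent ends x y) =
      hatC p e₁ e₂ e₃ * prob (hatWeights p e₁ e₂ e₃) (avoidAll (hatGraph ends a₁ a₂ w e₁ e₂ e₃) a₂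
        {a₁} ∩ connEvent (hatGraph ends a₁ a₂ w e₁ e₂ e₃) x y) := by
  refine prob_scale_of_Q h p hN hAN hBN ?_ ?_ ?_
  · intro ω hG
    simp only [Set.mem_inter_iff, avoidAll, Set.mem_setOf_eq, Finset.mem_singleton, forall_eq,
      connEvent, conn_hatGraph_iff h hG h.ua2.symm h.ua1.symm, conn_hatGraph_iff h hG hx hy]
  · exact subset_HatG_of_Q h fun ω hω hc => hω.1 a₁ (Finset.mem_singleton_self a₁) (conn_symm hc)
  · exact subset_HatG23_of_Q h fun ω hω hc => hω.1 a₁ (Finset.mem_singleton_self a₁) (conn_symm hc)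

/-- `P(Q)` scales. -/
lemma prob_Q_hat (h : IsHatAt ends u a₁ a₂ w e₁ e₂ e₃) (p : E → R)
    (hN : hatN p e₁ e₂ e₃ ≠ 0) (hAN : hatA p e₁ e₂ e₃ + hatN p e₁ e₂ e₃ ≠ 0)
    (hBN : hatB p e₁ e₂ e₃ + hatN p e₁ e₂ e₃ ≠ 0) :
    prob p (avoidAll ends a₂ {a₁}) =
      hatC p e₁ e₂ e₃ * prob (hatWeights p e₁ e₂ e₃)
        (avoidAll (hatGraph ends a₁ a₂ w e₁ e₂ e₃) a₂ {a₁}) := by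
  refine prob_scale_of_Q h p hN hAN hBN ?_ ?_ ?_
  · intro ω hG
    simp only [avoidAll, Set.mem_setOf_eq, Finset.mem_singleton, forall_eq,
      conn_hatGraph_iff h hG h.ua2.symm h.ua1.symm]
  · exact subset_HatG_of_Q h fun ω hω hc => hω a₁ (Finset.mem_singleton_self a₁) (conn_symm hc)
  · exact subset_HatG23_of_Q h fun ω hω hc => hω a₁ (Finset.mem_singleton_self a₁) (conn_symm hc)

/-- `P(PD ∩ X ∩ X')` scales. -/
lemma prob_PD_inter2_hat (h : IsHatAt ends u a₁ a₂ w e₁ e₂ e₃) (p : E → R)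
    (hN : hatN p e₁ e₂ e₃ ≠ 0) (hAN : hatA p e₁ e₂ e₃ + hatN p e₁ e₂ e₃ ≠ 0)
    (hBN : hatB p e₁ e₂ e₃ + hatN p e₁ e₂ e₃ ≠ 0) {a₃ x y z t : V} (h3 : a₃ ≠ u) (hx : x ≠ u)
    (hy : y ≠ u) (hz : z ≠ u) (ht : t ≠ u) :
    prob p (PDEvent ends a₁ a₂ a₃ ∩ (connEvent ends x y ∩ connEvent ends z t)) =
      hatC p e₁ e₂ e₃ * prob (hatWeights p e₁ e₂ e₃) (PDEvent (hatGraph ends a₁ a₂ w e₁ e₂ e₃) a₁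
        a₂ a₃ ∩ (connEvent (hatGraph ends a₁ a₂ w e₁ e₂ e₃) x y ∩
          connEvent (hatGraph ends a₁ a₂ w e₁ e₂ e₃) z t)) := by
  refine prob_scale_of_Q h p hN hAN hBN ?_ ?_ ?_
  · intro ω hG
    simp only [Set.mem_inter_iff, PDEvent, Dtilde, UnionCluster.inU, Set.mem_compl_iff, Set.mem_union,
      connEvent, Set.mem_setOf_eq, conn_hatGraph_iff h hG h.ua1.symm h.ua2.symm,
      conn_hatGraph_iff h hG h3 h.ua1.symm, conn_hatGraph_iff h hG h3 h.ua2.symm,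
      conn_hatGraph_iff h hG hx hy, conn_hatGraph_iff h hG hz ht]
  · exact subset_HatG_of_Q h fun ω hω hc => hω.1.1 hc
  · exact subset_HatG23_of_Q h fun ω hω hc => hω.1.1 hc

/-- `P(PD ∩ X)` scales. -/
lemma prob_PD_inter1_hat (h : IsHatAt ends u a₁ a₂ w e₁ e₂ e₃) (p : E → R)
    (hN : hatN p e₁ e₂ e₃ ≠ 0) (hAN : hatA p e₁ e₂ e₃ + hatN p e₁ e₂ e₃ ≠ 0)
    (hBN : hatB p e₁ e₂ e₃ + hatN p e₁ e₂ e₃ ≠ 0) {a₃ x y : V} (h3 : a₃ ≠ u) (hx : x ≠ u)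
    (hy : y ≠ u) :
    prob p (PDEvent ends a₁ a₂ a₃ ∩ connEvent ends x y) =
      hatC p e₁ e₂ e₃ * prob (hatWeights p e₁ e₂ e₃) (PDEvent (hatGraph ends a₁ a₂ w e₁ e₂ e₃) a₁
        a₂ a₃ ∩ connEvent (hatGraph ends a₁ a₂ w e₁ e₂ e₃) x y) := by
  refine prob_scale_of_Q h p hN hAN hBN ?_ ?_ ?_
  · intro ω hG
    simp only [Set.mem_inter_iff, PDEvent, Dtilde, UnionCluster.inU, Set.mem_compl_iff, Set.mem_union,
      connEvent, Set.mem_setOf_eq, conn_hatGraph_iff h hG h.ua1.symm h.ua2.symm,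
      conn_hatGraph_iff h hG h3 h.ua1.symm, conn_hatGraph_iff h hG h3 h.ua2.symm,
      conn_hatGraph_iff h hG hx hy]
  · exact subset_HatG_of_Q h fun ω hω hc => hω.1.1 hc
  · exact subset_HatG23_of_Q h fun ω hω hc => hω.1.1 hc

/-- `P(PD)` scales. -/
lemma prob_PD_hat (h : IsHatAt ends u a₁ a₂ w e₁ e₂ e₃) (p : E → R)
    (hN : hatN p e₁ e₂ e₃ ≠ 0) (hAN : hatA p e₁ e₂ e₃ + hatN p e₁ e₂ e₃ ≠ 0)
    (hBN : hatB p e₁ e₂ e₃ + hatN p e₁ e₂ e₃ ≠ 0) {a₃ : V} (h3 : a₃ ≠ u) :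
    prob p (PDEvent ends a₁ a₂ a₃) =
      hatC p e₁ e₂ e₃ * prob (hatWeights p e₁ e₂ e₃)
        (PDEvent (hatGraph ends a₁ a₂ w e₁ e₂ e₃) a₁ a₂ a₃) := by
  refine prob_scale_of_Q h p hN hAN hBN ?_ ?_ ?_
  · intro ω hG
    simp only [Set.mem_inter_iff, PDEvent, Dtilde, UnionCluster.inU, Set.mem_compl_iff, Set.mem_union,
      connEvent, Set.mem_setOf_eq, conn_hatGraph_iff h hG h.ua1.symm h.ua2.symm,
      conn_hatGraph_iff h hG h3 h.ua1.symm, conn_hatGraph_iff h hG h3 h.ua2.symm]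
  · exact subset_HatG_of_Q h fun ω hω hc => hω.1 hc
  · exact subset_HatG23_of_Q h fun ω hω hc => hω.1 hc

/-- `P(T ∩ X ∩ X')` scales, `T = TEvent r s a₃` for `{r, s} = {a₁, a₂}`. -/
lemma prob_T_inter2_hat (h : IsHatAt ends u a₁ a₂ w e₁ e₂ e₃) (p : E → R)
    (hN : hatN p e₁ e₂ e₃ ≠ 0) (hAN : hatA p e₁ e₂ e₃ + hatN p e₁ e₂ e₃ ≠ 0)
    (hBN : hatB p e₁ e₂ e₃ + hatN p e₁ e₂ e₃ ≠ 0) {r s a₃ x y z t : V}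
    (hrs : (r = a₁ ∧ s = a₂) ∨ (r = a₂ ∧ s = a₁)) (h3 : a₃ ≠ u) (hx : x ≠ u) (hy : y ≠ u)
    (hz : z ≠ u) (ht : t ≠ u) :
    prob p (TEvent ends r s a₃ ∩ (connEvent ends x y ∩ connEvent ends z t)) =
      hatC p e₁ e₂ e₃ * prob (hatWeights p e₁ e₂ e₃) (TEvent (hatGraph ends a₁ a₂ w e₁ e₂ e₃) r s
        a₃ ∩ (connEvent (hatGraph ends a₁ a₂ w e₁ e₂ e₃) x y ∩
          connEvent (hatGraph ends a₁ a₂ w e₁ e₂ e₃) z t)) := by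
  have hru : r ≠ u := by
    rcases hrs with ⟨rfl, -⟩ | ⟨rfl, -⟩
    · exact h.ua1.symm
    · exact h.ua2.symm
  have hsu : s ≠ u := by
    rcases hrs with ⟨-, rfl⟩ | ⟨-, rfl⟩
    · exact h.ua2.symm
    · exact h.ua1.symm
  refine prob_scale_of_Q h p hN hAN hBN ?_ ?_ ?_
  · intro ω hG
    simp only [Set.mem_inter_iff, TEvent, Set.mem_compl_iff, connEvent, Set.mem_setOf_eq,
      conn_hatGraph_iff h hG hsu hru, conn_hatGraph_iff h hG hsu h3, conn_hatGraph_iff h hG hx hy,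
      conn_hatGraph_iff h hG hz ht]
  · refine subset_HatG_of_Q h fun ω hω hc => hω.1.1 ?_
    rcases hrs with ⟨rfl, rfl⟩ | ⟨rfl, rfl⟩
    · exact conn_symm hc
    · exact hc
  · refine subset_HatG23_of_Q h fun ω hω hc => hω.1.1 ?_
    rcases hrs with ⟨rfl, rfl⟩ | ⟨rfl, rfl⟩
    · exact conn_symm hc
    · exact hc

/-- `P(T ∩ X)` scales. -/
lemma prob_T_inter1_hat (h : IsHatAt ends u a₁ a₂ w e₁ e₂ e₃) (p : E → R)
    (hN : hatN p e₁ e₂ e₃ ≠ 0) (hAN : hatA p e₁ e₂ e₃ + hatN p e₁ e₂ e₃ ≠ 0)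
    (hBN : hatB p e₁ e₂ e₃ + hatN p e₁ e₂ e₃ ≠ 0) {r s a₃ x y : V}
    (hrs : (r = a₁ ∧ s = a₂) ∨ (r = a₂ ∧ s = a₁)) (h3 : a₃ ≠ u) (hx : x ≠ u) (hy : y ≠ u) :
    prob p (TEvent ends r s a₃ ∩ connEvent ends x y) =
      hatC p e₁ e₂ e₃ * prob (hatWeights p e₁ e₂ e₃) (TEvent (hatGraph ends a₁ a₂ w e₁ e₂ e₃) r s
        a₃ ∩ connEvent (hatGraph ends a₁ a₂ w e₁ e₂ e₃) x y) := by
  have hru : r ≠ u := by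
    rcases hrs with ⟨rfl, -⟩ | ⟨rfl, -⟩
    · exact h.ua1.symm
    · exact h.ua2.symm
  have hsu : s ≠ u := by
    rcases hrs with ⟨-, rfl⟩ | ⟨-, rfl⟩
    · exact h.ua2.symm
    · exact h.ua1.symm
  refine prob_scale_of_Q h p hN hAN hBN ?_ ?_ ?_
  · intro ω hG
    simp only [Set.mem_inter_iff, TEvent, Set.mem_compl_iff, connEvent, Set.mem_setOf_eq,
      conn_hatGraph_iff h hG hsu hru, conn_hatGraph_iff h hG hsu h3, conn_hatGraph_iff h hG hx hy]
  · refine subset_HatG_of_Q h fun ω hω hc => hω.1.1 ?_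
    rcases hrs with ⟨rfl, rfl⟩ | ⟨rfl, rfl⟩
    · exact conn_symm hc
    · exact hc
  · refine subset_HatG23_of_Q h fun ω hω hc => hω.1.1 ?_
    rcases hrs with ⟨rfl, rfl⟩ | ⟨rfl, rfl⟩
    · exact conn_symm hc
    · exact hc

/-- `P(T)` scales. -/
lemma prob_T_hat (h : IsHatAt ends u a₁ a₂ w e₁ e₂ e₃) (p : E → R)
    (hN : hatN p e₁ e₂ e₃ ≠ 0) (hAN : hatA p e₁ e₂ e₃ + hatN p e₁ e₂ e₃ ≠ 0)
    (hBN : hatB p e₁ e₂ e₃ + hatN p e₁ e₂ e₃ ≠ 0) {r s a₃ : V}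
    (hrs : (r = a₁ ∧ s = a₂) ∨ (r = a₂ ∧ s = a₁)) (h3 : a₃ ≠ u) :
    prob p (TEvent ends r s a₃) =
      hatC p e₁ e₂ e₃ * prob (hatWeights p e₁ e₂ e₃)
        (TEvent (hatGraph ends a₁ a₂ w e₁ e₂ e₃) r s a₃) := by
  have hru : r ≠ u := by
    rcases hrs with ⟨rfl, -⟩ | ⟨rfl, -⟩
    · exact h.ua1.symm
    · exact h.ua2.symm
  have hsu : s ≠ u := by
    rcases hrs with ⟨-, rfl⟩ | ⟨-, rfl⟩
    · exact h.ua2.symm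
    · exact h.ua1.symm
  refine prob_scale_of_Q h p hN hAN hBN ?_ ?_ ?_
  · intro ω hG
    simp only [Set.mem_inter_iff, TEvent, Set.mem_compl_iff, connEvent, Set.mem_setOf_eq,
      conn_hatGraph_iff h hG hsu hru, conn_hatGraph_iff h hG hsu h3]
  · refine subset_HatG_of_Q h fun ω hω hc => hω.1 ?_
    rcases hrs with ⟨rfl, rfl⟩ | ⟨rfl, rfl⟩
    · exact conn_symm hc
    · exact hc
  · refine subset_HatG23_of_Q h fun ω hω hc => hω.1 ?_
    rcases hrs with ⟨rfl, rfl⟩ | ⟨rfl, rfl⟩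
    · exact conn_symm hc
    · exact hc

/-- **The gap scales**: the inadmissible parts of `{a₂ ↔ b}` and `{a₁ ↔ b}` coincide on both
sides (`a₁ ↔ a₂` through `u`, resp. through `w`). -/
lemma gap_hat (h : IsHatAt ends u a₁ a₂ w e₁ e₂ e₃) (p : E → R)
    (hN : hatN p e₁ e₂ e₃ ≠ 0) (hAN : hatA p e₁ e₂ e₃ + hatN p e₁ e₂ e₃ ≠ 0)
    (hBN : hatB p e₁ e₂ e₃ + hatN p e₁ e₂ e₃ ≠ 0) {b : V} (hb : b ≠ u) :
    gap p ends a₁ a₂ b = hatC p e₁ e₂ e₃ * gap (hatWeights p e₁ e₂ e₃) (hatGraph ends a₁ a₂ w e₁ e₂ e₃)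
      a₁ a₂ b := by
  unfold gap
  -- the admissible parts are carried by the hat map
  have hadm : ∀ x, x ≠ u → prob p (connEvent ends x b ∩ HatG e₁ e₂) = hatC p e₁ e₂ e₃ *
      prob (hatWeights p e₁ e₂ e₃) (connEvent (hatGraph ends a₁ a₂ w e₁ e₂ e₃) x b ∩ HatG e₂ e₃) := by
    intro x hx
    have h1 : connEvent ends x b ∩ HatG e₁ e₂ =
        hatMap e₁ e₂ e₃ ⁻¹' connEvent (hatGraph ends a₁ a₂ w e₁ e₂ e₃) x b ∩ HatG e₁ e₂ := by
      ext ω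
      simp only [Set.mem_inter_iff, Set.mem_preimage, connEvent, Set.mem_setOf_eq]
      constructor
      · rintro ⟨hc, hG⟩
        exact ⟨(conn_hatGraph_iff h hG hx hb).1 hc, hG⟩
      · rintro ⟨hc, hG⟩
        exact ⟨(conn_hatGraph_iff h hG hx hb).2 hc, hG⟩
    rw [h1, prob_hat_pushforward h.e12 h.e13 h.e23 p hN hAN hBN]
  -- the inadmissible parts coincide
  have hin : prob p (connEvent ends a₂ b ∩ (HatG e₁ e₂)ᶜ) =
      prob p (connEvent ends a₁ b ∩ (HatG e₁ e₂)ᶜ) := by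
    congr 1
    ext ω
    simp only [Set.mem_inter_iff, connEvent, Set.mem_setOf_eq, Set.mem_compl_iff]
    constructor
    · rintro ⟨hc, hG⟩
      exact ⟨conn_trans (conn_roots_of_not_mem_HatG h hG) hc, hG⟩
    · rintro ⟨hc, hG⟩
      exact ⟨conn_trans (conn_symm (conn_roots_of_not_mem_HatG h hG)) hc, hG⟩
  have hin' : prob (hatWeights p e₁ e₂ e₃) (connEvent (hatGraph ends a₁ a₂ w e₁ e₂ e₃) a₂ b ∩
      (HatG e₂ e₃)ᶜ) = prob (hatWeights p e₁ e₂ e₃)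
        (connEvent (hatGraph ends a₁ a₂ w e₁ e₂ e₃) a₁ b ∩ (HatG e₂ e₃)ᶜ) := by
    congr 1
    ext ω
    simp only [Set.mem_inter_iff, connEvent, Set.mem_setOf_eq, Set.mem_compl_iff]
    constructor
    · rintro ⟨hc, hG⟩
      exact ⟨conn_trans (conn_roots_hat_of_not_mem_HatG h hG) hc, hG⟩
    · rintro ⟨hc, hG⟩
      exact ⟨conn_trans (conn_symm (conn_roots_hat_of_not_mem_HatG h hG)) hc, hG⟩
  rw [← prob_inter_add_prob_inter_compl p (connEvent ends a₂ b) (HatG e₁ e₂),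
    ← prob_inter_add_prob_inter_compl p (connEvent ends a₁ b) (HatG e₁ e₂),
    ← prob_inter_add_prob_inter_compl (hatWeights p e₁ e₂ e₃) _ (HatG e₂ e₃),
    ← prob_inter_add_prob_inter_compl (hatWeights p e₁ e₂ e₃)
      (connEvent (hatGraph ends a₁ a₂ w e₁ e₂ e₃) a₁ b) (HatG e₂ e₃),
    hadm a₂ h.ua2.symm, hadm a₁ h.ua1.symm, hin, hin']
  ring

end Masses

section Gc

variable {V : Type*} {E : Type*} [Fintype E] [DecidableEq E] [DecidableEq V] {R : Type*}
  [Field R] {ends : E → Sym2 V} {o a₁ a₂ a₃ b u w : V} {e₁ e₂ e₃ : E}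

/-- **THE HAT SCALES THE COVARIANCE FORM**: `Gc p ends = c³ · Gc (hatWeights p) (hatGraph ends)`
for a hat `u` off the five marks. -/
theorem Gc_hat (h : IsHatAt ends u a₁ a₂ w e₁ e₂ e₃) (p : E → R)
    (hN : hatN p e₁ e₂ e₃ ≠ 0) (hAN : hatA p e₁ e₂ e₃ + hatN p e₁ e₂ e₃ ≠ 0)
    (hBN : hatB p e₁ e₂ e₃ + hatN p e₁ e₂ e₃ ≠ 0) (huo : o ≠ u) (hu3 : a₃ ≠ u) (hub : b ≠ u) :
    Gc p ends o a₁ a₂ a₃ b = hatC p e₁ e₂ e₃ ^ 3 *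
      Gc (hatWeights p e₁ e₂ e₃) (hatGraph ends a₁ a₂ w e₁ e₂ e₃) o a₁ a₂ a₃ b := by
  have hu1 : a₁ ≠ u := h.ua1.symm
  have hu2 : a₂ ≠ u := h.ua2.symm
  simp only [Gc, DEF, EQbo, EQb3, EQb3o, EQo, EQ3, EQ3o, PDb, PDbo, Do,
    prob_Q_inter2_hat h p hN hAN hBN hu1 huo hu2 hub,
    prob_Q_inter2_hat h p hN hAN hBN hu2 huo hu1 hub, prob_Q_inter2_hat h p hN hAN hBN hu2 huo hu2 hub,
    prob_Q_inter2_hat h p hN hAN hBN hu1 huo hu1 hub,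
    prob_Q_inter1_hat h p hN hAN hBN hu1 huo, prob_Q_inter1_hat h p hN hAN hBN hu2 huo,
    prob_Q_hat h p hN hAN hBN,
    prob_PD_inter2_hat h p hN hAN hBN hu3 hu1 huo hu1 hub, prob_PD_inter2_hat h p hN hAN hBN hu3 hu2 huo hu1 hub,
    prob_PD_inter2_hat h p hN hAN hBN hu3 hu1 huo hu2 hub, prob_PD_inter2_hat h p hN hAN hBN hu3 hu2 huo hu2 hub,
    prob_PD_inter1_hat h p hN hAN hBN hu3 hu1 huo, prob_PD_inter1_hat h p hN hAN hBN hu3 hu2 huo,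
    prob_PD_inter1_hat h p hN hAN hBN hu3 hu1 hub, prob_PD_inter1_hat h p hN hAN hBN hu3 hu2 hub,
    prob_PD_hat h p hN hAN hBN hu3,
    prob_T_inter2_hat h p hN hAN hBN (Or.inl ⟨rfl, rfl⟩) hu3 hu1 huo hu1 hub,
    prob_T_inter2_hat h p hN hAN hBN (Or.inl ⟨rfl, rfl⟩) hu3 hu2 huo hu1 hub,
    prob_T_inter2_hat h p hN hAN hBN (Or.inl ⟨rfl, rfl⟩) hu3 hu1 huo hu2 hub,
    prob_T_inter2_hat h p hN hAN hBN (Or.inl ⟨rfl, rfl⟩) hu3 hu2 huo hu2 hub,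
    prob_T_inter2_hat h p hN hAN hBN (Or.inr ⟨rfl, rfl⟩) hu3 hu1 huo hu1 hub,
    prob_T_inter2_hat h p hN hAN hBN (Or.inr ⟨rfl, rfl⟩) hu3 hu2 huo hu1 hub,
    prob_T_inter2_hat h p hN hAN hBN (Or.inr ⟨rfl, rfl⟩) hu3 hu1 huo hu2 hub,
    prob_T_inter2_hat h p hN hAN hBN (Or.inr ⟨rfl, rfl⟩) hu3 hu2 huo hu2 hub,
    prob_T_inter1_hat h p hN hAN hBN (Or.inl ⟨rfl, rfl⟩) hu3 hu1 huo,
    prob_T_inter1_hat h p hN hAN hBN (Or.inl ⟨rfl, rfl⟩) hu3 hu2 huo,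
    prob_T_inter1_hat h p hN hAN hBN (Or.inl ⟨rfl, rfl⟩) hu3 hu1 hub,
    prob_T_inter1_hat h p hN hAN hBN (Or.inl ⟨rfl, rfl⟩) hu3 hu2 hub,
    prob_T_inter1_hat h p hN hAN hBN (Or.inr ⟨rfl, rfl⟩) hu3 hu1 huo,
    prob_T_inter1_hat h p hN hAN hBN (Or.inr ⟨rfl, rfl⟩) hu3 hu2 huo,
    prob_T_inter1_hat h p hN hAN hBN (Or.inr ⟨rfl, rfl⟩) hu3 hu1 hub,
    prob_T_inter1_hat h p hN hAN hBN (Or.inr ⟨rfl, rfl⟩) hu3 hu2 hub,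
    prob_T_hat h p hN hAN hBN (Or.inl ⟨rfl, rfl⟩) hu3, prob_T_hat h p hN hAN hBN (Or.inr ⟨rfl, rfl⟩) hu3,
    gap_hat h p hN hAN hBN hub]
  ring

end Gc


end Hat

end Summit.Ventures.PercRepro2
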